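import Summits.ABC.IUTFork.Joshi.ArithTeichmullerAction
import Mathlib.Data.Setoid.Partition
import HarnessLib

/-!
# Joshi's ATS I, §6 «Connectedness of Arithmetic Teichmüller Spaces and the abs. Grothendieck Conjecture» and
# §8 «Galois cohomology» (Prop. 8.3.1, Thm. 8.4.1, Cor. 8.5.1 collation) — typed over E-t1's carriers

Block E of the abc-iut cell (rung LADDER-ABC:A2.E; seat abc-iut-E-t13, slot T-49 of the [J-I] fan-out, E-plan-2 07:04:11Z,
E-t1 assent 07:20:45Z; inventory `plan/E/t13/INVENTORY-T49.tsv`). SOURCE: K. Joshi, *Construction of Arithmetic Teichmüller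
Spaces I*, arXiv:2106.11452**v4** (UNREFEREED «Preliminary version»; bib `Joshi2021ATS1`; the series is rejected by the IUT author,
`Mochizuki2024JoshiReport`). Locators «p. N l. a–b» = PDF page N, lines a–b of the cell's PDF-paged render
`plan/repair/lit/renders/Joshi-ATS1-2106.11452v4-PDFpaged-book-anonnd/pNNNN.txt`. NO SIDE TAKEN on [IUTchIII] Cor. 3.12, on
Joshi's claims or on Mochizuki's reports; TYPED ≠ PROVED ≠ ENDORSED: every printed assertion is a `def … : Prop` tagged
`@[claim "Joshi2021ATS1" "disputed"]` (E-t1's registered tag), never an axiom / instance / `sorry` / Literature fact; what FOLLOWS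
from the typed signature is a proved `theorem`. CARRIERS (r1–r3): E-t1's `Joshi.Untilt`, `Joshi.ATSObj X` (objects `(Y/E′, E′ ↪ K,
α)` of `𝔍(X,E)` over the tree's `TemperedCurve p`), `ATSObj.self/.nonempty/.embPadicComplex`, and E-t1's ABSTRACT-PREDICATE convention
of `ATSObj.StrictBelyiRigidity`: the curves are behind the `TemperedCurve` interface (no scheme), so «isomorphic as `ℤ`-schemes» is
an abstract relation `IsoSch` and «hyperbolic curve of strict Belyi type» an abstract predicate `IsSB` (OUR nearest decl, other
curve model: `Literature.AnabelianGeometry.AbsoluteAnabelian.AbsTopII.…IsStrictlyBelyiType` — pointer only). Nothing of E-t1 is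
re-typed. `𝔍_hyp(X,E)` / `𝔍_SB(X,E)` (v4 §5.8–5.9) are E-t21's (T-48): here `strictBelyiSub IsSB X := {A | IsSB A.Y}` is a READING
of `𝔍_SB(X,E)` (merge-debt E-t21), and arbitrary full subcategories are `J : Set (ATSObj X)`.

TYPED. §6.1 the Absolute Grothendieck Conjecture in Joshi's formulation (existence-level reading) and its strict-Belyi case
(«established by Mochizuki [2007b, Cor. 2.12]» — a HYPOTHESIS here; not on the cell's FACT-LIST) · Def. 6.2.1 connectedness · Rmk.
6.2.2 connected components (DERIVED: a setoid partition) · Thm. 6.2.3 (1)(2) (claims + DERIVED) · Thm. 6.3.1 (1)(2) (claims over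
abstract `IsSB`, field-of-moduli map `lmod`, `DefinableOver`) + the «common `L_mod`» clause DERIVED · Rmk. 6.3.2 (reading) · §8.1
the standard arithmetic holomorphic structure `ATSObj.standard` · Prop. 8.3.1 the Kummer-theory / Galois-cohomology ASSIGNMENT
(signature `KummerGaloisCohomology`; continuous cohomology is not in Mathlib ⇒ abstract carriers as unbundled instance parameters)
· Thm. 8.4.1 as transport DATA `CohTransport` + claim `Thm841` · Cor. 8.5.1 COLLATION `CohTransport.collate` DEFINED («the union of
the images … under all the isomorphisms provided by Theorem 8.4.1») with its elementary properties DERIVED · Rmk. 8.5.2 (reading).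
DICTIONARY toward OUR interface (recorded, not bound — R14): collation over ALL anabelomorphisms ↔ the `⟨(Ind1)∪(Ind2)⟩`-orbit of
Kummer classes in `Thm311.LogShells` (`Ind1Family/Ind2Family`); adelic version = J2h Prop. 7.5.1 (E-t38 `ATS2half.CohomologyDatum`),
J3 Prop. 9.7.5.1 (E-t21) — D-10 support for E-t18's `DictionaryCollation`. PRINT NOTE: Thm. 8.4.1 (1) prints «anabelomorphism
`Π^temp_{X/E;K} ≃ Π^temp_{X/E;ℂ_p}`» where the groups compared are `Π^temp_{Y/E′;K}` and `Π^temp_{X/E;ℂ_p}` (p. 45 l. 42–53) — typed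
with the object's label `Y`. Standard axioms only; sorry-free; nothing asserted.
-/

noncomputable section

open Set

namespace Summit.ABC.IUTFork.Joshi

open Literature.AnabelianGeometry.SemiGraphs (TemperedCurve)

variable {p : ℕ} [Fact p.Prime]

/-! ## §6.1 The Absolute Grothendieck Conjecture (Joshi's formulation) -/

/-- **§6.1, the Absolute Grothendieck Conjecture for a pair** (p. 38 l. 22–36: «My formulation … is based on [Mochizuki, 2007b,
Corollary 2.3]. This conjecture asserts the following. … let `X/E` (resp. `Y/E′`) be a geometrically connected, smooth
quasi-projective variety over a p-adic field `E` (resp. `E′`). Then any isomorphism of topological groups `Π^temp_{X/E} ≃ Π^temp_{Y/E′}`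
arises from an isomorphism of `ℤ`-schemes `X ≃ Y`»; l. 37–38 «As stated this is, of course, a very optimistic formulation»). READING
at existence level (the curves are behind the `TemperedCurve` interface): a topological isomorphism of tempered fundamental groups
implies `IsoSch X Y`. WEAKER than print's «arises from». [claim: Joshi2021ATS1, status: disputed] -/
@[claim "Joshi2021ATS1" "disputed"]
def AbsoluteGrothendieckConjecture (IsoSch : TemperedCurve p → TemperedCurve p → Prop) (X Y : TemperedCurve p) : Prop :=
  Nonempty (X.PiTemp ≃ₜ* Y.PiTemp) → IsoSch X Y

/-- **§6.1, the known case as Joshi states it** (p. 38 l. 38–41: «The only case in which this conjecture is presently known is the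
case of geometrically connected, smooth, hyperbolic curves of Strict Belyi Type over p-adic fields. This case was established by
Mochizuki in [Mochizuki, 2007b, Corollary 2.12]»; used again p. 39 l. 16–18). HYPOTHESIS — a published theorem of Mochizuki CITED by
Joshi, over the abstract predicates; NOT on the cell's FACT-LIST, never asserted here. [claim: Joshi2021ATS1, status: disputed] -/
@[claim "Joshi2021ATS1" "disputed"]
def AGCForStrictBelyi (IsSB : TemperedCurve p → Prop) (IsoSch : TemperedCurve p → TemperedCurve p → Prop) : Prop :=
  ∀ X Y : TemperedCurve p, IsSB X → IsSB Y → AbsoluteGrothendieckConjecture IsoSch X Y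

namespace ATSObj

variable (IsSB : TemperedCurve p → Prop) (IsoSch : TemperedCurve p → TemperedCurve p → Prop) (X : TemperedCurve p)

/-! ## §6.2 Connectedness -/

/-- **Def. 6.2.1** (p. 38 l. 45–51): «`𝔍(X,E)` (resp. any full subcategory `𝔍` of `𝔍(X,E)` …) is a connected Arithmetic Teichmüller
Space (resp. is connected) if for every object `(Y/E′, (E′ ↪ K, K^♭ ≃ F), ∗_K : 𝓜(K) → Y^an_{E′}) ∈ 𝔍` … one has an isomorphism `X ≃
Y` of schemes over `ℤ`» — for a full subcategory given as a set of objects (orientation `IsoSch A.Y X` as in E-t1's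
`StrictBelyiRigidity`). [claim: Joshi2021ATS1, status: disputed] -/
@[claim "Joshi2021ATS1" "disputed"]
def IsConnectedSub (J : Set (ATSObj X)) : Prop := ∀ A ∈ J, IsoSch A.Y X

/-- **Def. 6.2.1, the whole space**: «`𝔍(X,E)` is a connected Arithmetic Teichmüller Space». [claim: Joshi2021ATS1, status: disputed] -/
@[claim "Joshi2021ATS1" "disputed"]
def IsConnectedATS : Prop := IsConnectedSub IsoSch X Set.univ

/-- READING of `𝔍_SB(X,E)` (v4 §5.9; E-t21's T-48 object — merge-debt): the full subcategory of objects whose curve `Y/E′` is of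
strict Belyi type. [claim: Joshi2021ATS1, status: disputed] -/
@[claim "Joshi2021ATS1" "disputed"]
def strictBelyiSub : Set (ATSObj X) := {A | IsSB A.Y}

variable {IsoSch X} in
/-- Connectedness is inherited by smaller full subcategories. [folklore] -/
theorem IsConnectedSub.mono {J J' : Set (ATSObj X)} (h : IsConnectedSub IsoSch X J) (hJ : J' ⊆ J) :
    IsConnectedSub IsoSch X J' := fun A hA => h A (hJ hA)

/-- **Rmk. 6.2.2, the equivalence relation** (p. 39 l. 1–3: «Since isomorphism of `ℤ`-schemes is an equivalence relation on schemes,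
one sees that the class of objects of `𝔍(X,E)` … can be partitioned, by this equivalence relation, into a disjoint union of connected
components»): the setoid on objects induced by `IsoSch` on their curves. [claim: Joshi2021ATS1, status: disputed] -/
def componentSetoid (hE : Equivalence IsoSch) : Setoid (ATSObj X) where
  r A B := IsoSch A.Y B.Y
  iseqv := ⟨fun A => hE.refl A.Y, fun h => hE.symm h, fun h h' => hE.trans h h'⟩

/-- **Rmk. 6.2.2 DERIVED**: the connected components (classes of `componentSetoid`) partition the objects of `𝔍(X,E)`. [folklore] -/
theorem components_isPartition (hE : Equivalence IsoSch) : Setoid.IsPartition (componentSetoid IsoSch X hE).classes :=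
  Setoid.isPartition_classes _

/-! ## §8.1 The standard arithmetic holomorphic structure (used by §6.2's derivation and by §8) -/

/-- **§8.1 the standard arithmetic holomorphic structure on `X/E`** (p. 44 l. 12–35: «Choose an arithmetic holomorphic structure
`(X/E, (ℂ_p ⊃ E, ℂ_p^♭ →id ℂ_p^♭), ∗_{ℂ_p} : 𝓜(ℂ_p) → X^an_E)` … I will refer to this as the standard arithmetic holomorphic structure on
`X/E`»): E-t1's object `(X/E, E ↪ ℂ_p, id)` (the witness of `ATSObj.nonempty`), named. [claim: Joshi2021ATS1, status: disputed] -/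
def standard : ATSObj X := ATSObj.self X (Untilt.padicComplex p) (embPadicComplex X) (continuous_embPadicComplex X)

/-- The standard structure has curve `X` itself. [folklore] -/
theorem standard_Y : (standard X).Y = X := rfl

variable {IsoSch X} in
/-- A connected space relates every two objects' curves (through `X`). [folklore] -/
theorem isoSch_of_isConnectedATS (hE : Equivalence IsoSch) (h : IsConnectedATS IsoSch X) (A B : ATSObj X) : IsoSch A.Y B.Y :=
  hE.trans (h A trivial) (hE.symm (h B trivial))

variable {IsoSch X} in
/-- **Rmk. 6.2.2 / Def. 6.2.1 DERIVED**: `𝔍(X,E)` is connected iff it has a single connected component, i.e. every object lies in the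
component of the standard structure. [folklore] -/
theorem isConnectedATS_iff_rel_standard (hE : Equivalence IsoSch) :
    IsConnectedATS IsoSch X ↔ ∀ A : ATSObj X, (componentSetoid IsoSch X hE).r A (standard X) :=
  ⟨fun h A => h A trivial, fun h A _ => h A⟩

/-! ## Thm. 6.2.3 -/

/-- **Thm. 6.2.3 (1)** (p. 39 l. 6–9): «If the Absolute Grothendieck Conjecture (see section 6.1) holds true for any pair of objects of
`𝔍(X,E)`, then `𝔍(X,E)` is a connected Arithmetic Teichmüller Space.» CLAIM (derivation below). [claim: Joshi2021ATS1, status: disputed] -/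
@[claim "Joshi2021ATS1" "disputed"]
def Thm623Part1 : Prop :=
  (∀ A B : ATSObj X, AbsoluteGrothendieckConjecture IsoSch A.Y B.Y) → IsConnectedATS IsoSch X

/-- **Thm. 6.2.3 (1) DERIVED** («immediate from the formulation of the Absolute Grothendieck Conjecture», p. 39 l. 12–14): every
object `A` carries the tempered anabelomorphism `α : Π^temp(Y/E′) ≅ Π^temp(X/E)` (its label), and `X` is itself the curve of the
standard object, so AGC for the pair `(A, standard)` gives `Y ≅ X`. [folklore] -/
theorem thm623Part1 : Thm623Part1 IsoSch X := fun h A _ => h A (standard X) ⟨A.α⟩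

/-- **Thm. 6.2.3 (2)** (p. 39 l. 10–11): «In particular if `X/E` is additionally an hyperbolic curve of strict Belyi Type [Mochizuki,
2007a] then the Arithmetic Teichmüller Space `𝔍_SB(X,E) = 𝔍_hyp(X,E)` is connected» — typed on the reading `strictBelyiSub` of
`𝔍_SB(X,E)` (the identification with `𝔍_hyp` is Prop. 5.8.2, E-t21). CLAIM. [claim: Joshi2021ATS1, status: disputed] -/
@[claim "Joshi2021ATS1" "disputed"]
def Thm623Part2 : Prop := IsSB X → IsConnectedSub IsoSch X (strictBelyiSub IsSB X)

/-- **Thm. 6.2.3 (2) DERIVED along the printed proof** (p. 39 l. 15–19: «By [Mochizuki, 2007b, Corollary 2.12] … the Absolute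
Grothendieck Conjecture holds for any pair of smooth, hyperbolic, anabelomorphic curves of Strict Belyi Type … Hence … connected»):
from the HYPOTHESIS `AGCForStrictBelyi`. [folklore] -/
theorem thm623Part2_of_agc (hM : AGCForStrictBelyi IsSB IsoSch) : Thm623Part2 IsSB IsoSch X :=
  fun hX A hA => hM A.Y X hA hX ⟨A.α⟩

/-- **Thm. 6.2.3 (2) DERIVED, second route**: it IS E-t1's `ATSObj.StrictBelyiRigidity` (v4 Prop. 5.9.1 (1), «for every `(Y/E′, E′ ↪
K) ∈ 𝔍_SB(X,E)` one has an isomorphism of schemes `Y ≅ X`»). [folklore] -/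
theorem thm623Part2_of_strictBelyiRigidity (h : StrictBelyiRigidity IsSB IsoSch X) : Thm623Part2 IsSB IsoSch X :=
  fun hX A hA => h hX A hA

/-- Conversely `StrictBelyiRigidity` follows from `AGCForStrictBelyi` (the relation between E-t1's Prop. 5.9.1 (1) and §6.1). [folklore] -/
theorem strictBelyiRigidity_of_agc (hM : AGCForStrictBelyi IsSB IsoSch) : StrictBelyiRigidity IsSB IsoSch X :=
  fun hX A hA => hM A.Y X hA hX ⟨A.α⟩

/-! ## §6.3 Field of definition (Thm. 6.3.1, Rmk. 6.3.2) -/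

/-- **Thm. 6.3.1 (1)** (p. 39 l. 28–31: «Let `X/E` be a geometrically connected, smooth hyperbolic curve over a p-adic field `E`.
Assume that `X` is of Strict Belyi Type … Then for every `(Y/E′, Y/K) ∈ 𝔍_hyp(X,E)`, (1) `Y/E′` is of strict Belyi Type»; proof p. 40
l. 8–11: amphoricity of strict Belyi type, [Mochizuki, 2007b, Prop. 2.4 (iv)]), for a full subcategory `J` standing for `𝔍_hyp(X,E)`
(E-t21). CLAIM, never asserted. [claim: Joshi2021ATS1, status: disputed] -/
@[claim "Joshi2021ATS1" "disputed"]
def Thm631Part1 (J : Set (ATSObj X)) : Prop := IsSB X → ∀ A ∈ J, IsSB A.Y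

variable {F : Type} (lmod : TemperedCurve p → F) (DefinableOver : TemperedCurve p → F → Prop)

/-- **Thm. 6.3.1 (2)** (p. 39 l. 30–34: «Let `L_mod` be the field of moduli of `X/E`. Then for every `(Y/E′, Y/K) ∈ 𝔍_hyp(X,E)` …
(2) `Y/E′` is definable over the number field `L_mod`. In particular, there is a common number field `L_mod` which is determined by
every object of `𝔍_hyp(X,E)`»), over an abstract field-of-moduli map `lmod` (values in a type `F` of number fields) and an abstract
predicate `DefinableOver`. CLAIM, never asserted. [claim: Joshi2021ATS1, status: disputed] -/
@[claim "Joshi2021ATS1" "disputed"]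
def Thm631Part2 (J : Set (ATSObj X)) : Prop :=
  IsSB X → ∀ A ∈ J, DefinableOver A.Y (lmod X) ∧ lmod A.Y = lmod X

variable {IsoSch X lmod} in
/-- **The «common `L_mod`» clause DERIVED from connectedness** (proof p. 40 l. 18–22: «The isomorphism `Y ≃ X` as `ℤ`-schemes provides
the same moduli point … `Y/E′` also has the field of moduli `L_mod`»): on a connected full subcategory, an `IsoSch`-invariant
field-of-moduli map is constant `= lmod X`. The invariance is the (folklore) input, a hypothesis here. [folklore] -/
theorem lmod_eq_of_isConnectedSub (hinv : ∀ Y Y' : TemperedCurve p, IsoSch Y Y' → lmod Y = lmod Y') {J : Set (ATSObj X)}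
    (hJ : IsConnectedSub IsoSch X J) {A : ATSObj X} (hA : A ∈ J) : lmod A.Y = lmod X :=
  hinv A.Y X (hJ A hA)

/-- **Rmk. 6.3.2** (p. 39 l. 35–40: «in the situation of Theorem 6.3.1, by [Joshi, 2022, Theorem 5.4(2)], one sees that `𝔍(X,E)` is a
connected Arithmetic Teichmüller Space and hence this common number field `L_mod` should be considered as the field of definition of
… `𝔍(X,E)` in a manner entirely analogous to the notion of the reflex field of a Shimura variety datum»). READING: the asserted
connectedness of the WHOLE space for `X` of strict Belyi type (input: JoshiUntilts arXiv:2210.11635 Thm. 5.4 (2), not typed here).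
[claim: Joshi2021ATS1, status: disputed] -/
@[claim "Joshi2021ATS1" "disputed"]
def Rmk632Reading : Prop := IsSB X → IsConnectedATS IsoSch X

end ATSObj

/-! ## §8.2–§8.3 Kummer theory and Galois cohomology provided by an arithmetic holomorphic structure (Prop. 8.3.1) -/

/-- **Prop. 8.3.1 — the ASSIGNMENT** (p. 45 l. 13–30: «Given any arithmetic holomorphic structure `(Y/E′, (E′ ↪ K, K^♭ ≃ F), ∗_K) ∈
𝔍(X,E)` one has, for each integer `i ≥ 0`, a Kummer Theory and continuous Galois cohomology given by the assignment (8.3.2) `G_{E′;K} ↷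
ℤ(1)_K, …`, (8.3.3) `(Y/E′, Y^an/K) ↦ H^i(Π^temp_{Y/E′;K}, Ẑ(1)_K)` and also (8.3.4) `(Y/E′, Y^an/K) ↦ H^i(G_{E′;K}, Ẑ(1)_K)`, and a similar
construction for the subspaces `H^1_e(G_{E′},−), H^1_f(G_{E′},−), H^1_g(G_{E′},−)`»; §8.2–8.3 p. 44 l. 36–109: `G_{E′;K} = Gal(Ē′/E′)` for the
preferred `Ē′ ⊂ K`, the modules `Ẑ(1)_K, ℤ_p(1)_K, ℚ(1)_K, ℚ_p(1)_K` «as `Π^temp_{Y/E′;K}`-modules through the quotient homomorphism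
`Π^temp ↠ G_{E′;K}`», [Bloch–Kato 1990] subspaces). SIGNATURE over UNBUNDLED carriers (continuous cohomology of profinite groups is not
in Mathlib): `HPi i A = H^i(Π^temp_{Y/E′;K}, Ẑ(1)_K)`, `HG i A = H^i(G_{E′;K}, Ẑ(1)_K)`, `HGQ i A = H^i(G_{E′;K}, ℚ_p(1)_K)` for every object
`A` of E-t1's `ATSObj X`; fields: the restriction maps along `Π^temp ↠ G` and the three subspaces of `H^1(G_{E′;K}, ℚ_p(1)_K)`. No
property asserted. OUR nearest vocabulary (pointer): `Literature.AnabelianGeometry.AbsoluteAnabelian.MonoidKummerTheory`. [claim: Joshi2021ATS1, status: disputed] -/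
structure KummerGaloisCohomology (X : TemperedCurve p) (HPi HG HGQ : ℕ → ATSObj X → Type) [∀ i A, AddCommGroup (HPi i A)]
    [∀ i A, AddCommGroup (HG i A)] [∀ i A, AddCommGroup (HGQ i A)] [∀ i A, Module ℚ_[p] (HGQ i A)] : Type 1 where
  /-- restriction `H^i(G_{E′;K}, Ẑ(1)_K) → H^i(Π^temp_{Y/E′;K}, Ẑ(1)_K)` along `Π^temp_{Y/E′;K} ↠ G_{E′;K}` (p. 44 l. 85–90) -/
  res : ∀ (i : ℕ) (A : ATSObj X), HG i A →+ HPi i A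
  /-- `H^i(G_{E′;K}, Ẑ(1)_K) → H^i(G_{E′;K}, ℚ_p(1)_K)` (change of coefficients `Ẑ(1) → ℚ_p(1)`) -/
  toQ : ∀ (i : ℕ) (A : ATSObj X), HG i A →+ HGQ i A
  /-- `H^1_e(G_{E′;K}, ℚ_p(1)_K)` [Bloch–Kato 1990] -/
  H1e : ∀ A : ATSObj X, Submodule ℚ_[p] (HGQ 1 A)
  /-- `H^1_f(G_{E′;K}, ℚ_p(1)_K)` -/
  H1f : ∀ A : ATSObj X, Submodule ℚ_[p] (HGQ 1 A)
  /-- `H^1_g(G_{E′;K}, ℚ_p(1)_K)` -/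
  H1g : ∀ A : ATSObj X, Submodule ℚ_[p] (HGQ 1 A)

namespace KummerGaloisCohomology

variable {X : TemperedCurve p} {HPi HG HGQ : ℕ → ATSObj X → Type} [∀ i A, AddCommGroup (HPi i A)]
  [∀ i A, AddCommGroup (HG i A)] [∀ i A, AddCommGroup (HGQ i A)] [∀ i A, Module ℚ_[p] (HGQ i A)]
  (C : KummerGaloisCohomology X HPi HG HGQ)

/-- **«the standard Kummer Theory and Galois cohomology»** (p. 45 l. 1–12: at the standard structure «simply write `G_E = Gal(Ē/E)`, and
`Ẑ(1) ⊂ ℂ_p` … and `H^i(G_E, ℤ(1))`, `H^i(G_E, ℤ_p(1))` etc.»; «Thus each arithmetic holomorphic structure in `𝔍(X,E)` provides us with a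
distinguished Kummer Theory»): the value of the assignment at `ATSObj.standard X`. [claim: Joshi2021ATS1, status: disputed] -/
abbrev stdHG (_ : KummerGaloisCohomology X HPi HG HGQ) (i : ℕ) : Type := HG i (ATSObj.standard X)

/-! ## Thm. 8.4.1 (transport along anabelomorphisms) and Cor. 8.5.1 (collation) -/

/-- **Thm. 8.4.1 as transport DATA** (p. 45 l. 32 – p. 46 l. 5): «Let `(Y/E′, …) ∈ 𝔍(X,E)` and let `(X/E, (ℂ_p ⊃ E, …))` be the standard
arithmetic holomorphic structure on `X/E`. Then (1) Any anabelomorphism `Π^temp_{X/E;K} ≃ Π^temp_{X/E;ℂ_p}` [sic: `Π^temp_{Y/E′;K} ≃ …`,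
PRINT NOTE] provides, for all integers `i ≥ 0`, an isomorphism of continuous cohomology groups `H^i(Π^temp_{Y/E′;K}, Ẑ(1)_K) ≃
H^i(Π^temp_{X/E;ℂ_p}, Ẑ(1))` and also an isomorphism `H^i(G_{E′;K}, Ẑ(1)_K) ≃ H^i(G_E, Ẑ(1))` and also an isomorphism (of `ℚ_p`-vector
spaces) `H^i(G_{E′;K}, ℚ_p(1)_K) ≃ H^i(G_E, ℚ_p(1))`, (2) and a similar isomorphism holds for the subgroups (resp. subspaces) `H^1_e,
H^1_f, H^1_g` …, for example `H^i_f(G_{E′;K}, ℚ_p(1)_K) ≃ H^i_f(G_E, ℚ_p(1))`» (proof: «the anabelomorphism `G_{E′;K} ≃ G_E` induces an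
isomorphism of `Ẑ(1)_K ≃ Ẑ(1)` … compatible», [Hoshi 2021, Prop. 4.2 (iv)] / [Mochizuki 2004, Prop. 1.2.1]; «these subgroups … are
amphoric»). «Provides» is typed as a FUNCTION of the anabelomorphism `φ`. SIGNATURE; the claim is `Thm841`. [claim: Joshi2021ATS1, status: disputed] -/
structure CohTransport (C : KummerGaloisCohomology X HPi HG HGQ) : Type 1 where
  /-- (1) on `H^i(Π^temp, Ẑ(1))` -/
  trPi : ∀ (A : ATSObj X) (_φ : A.Y.PiTemp ≃ₜ* X.PiTemp) (i : ℕ), HPi i A ≃+ HPi i (ATSObj.standard X)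
  /-- (1) on `H^i(G, Ẑ(1))` -/
  trG : ∀ (A : ATSObj X) (_φ : A.Y.PiTemp ≃ₜ* X.PiTemp) (i : ℕ), HG i A ≃+ HG i (ATSObj.standard X)
  /-- (1) on `H^i(G, ℚ_p(1))`, `ℚ_p`-linearly -/
  trGQ : ∀ (A : ATSObj X) (_φ : A.Y.PiTemp ≃ₜ* X.PiTemp) (i : ℕ), HGQ i A ≃ₗ[ℚ_[p]] HGQ i (ATSObj.standard X)
  /-- (2) for `H^1_e` -/
  map_H1e : ∀ (A : ATSObj X) (φ : A.Y.PiTemp ≃ₜ* X.PiTemp),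
    (C.H1e A).map (trGQ A φ 1 : HGQ 1 A →ₗ[ℚ_[p]] HGQ 1 (ATSObj.standard X)) = C.H1e (ATSObj.standard X)
  /-- (2) for `H^1_f` -/
  map_H1f : ∀ (A : ATSObj X) (φ : A.Y.PiTemp ≃ₜ* X.PiTemp),
    (C.H1f A).map (trGQ A φ 1 : HGQ 1 A →ₗ[ℚ_[p]] HGQ 1 (ATSObj.standard X)) = C.H1f (ATSObj.standard X)
  /-- (2) for `H^1_g` -/
  map_H1g : ∀ (A : ATSObj X) (φ : A.Y.PiTemp ≃ₜ* X.PiTemp),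
    (C.H1g A).map (trGQ A φ 1 : HGQ 1 A →ₗ[ℚ_[p]] HGQ 1 (ATSObj.standard X)) = C.H1g (ATSObj.standard X)

/-- **Thm. 8.4.1, the CLAIM**: the assignment of Prop. 8.3.1 admits the transport data along every anabelomorphism. Never asserted.
[claim: Joshi2021ATS1, status: disputed] -/
@[claim "Joshi2021ATS1" "disputed"]
def Thm841 : Prop := Nonempty (CohTransport C)

namespace CohTransport

variable {C} (T : CohTransport C)

/-- **Cor. 8.5.1 — COLLATION of cohomology classes, DEFINED** (p. 46 l. 9–26: «Let `i ≥ 0` … Let `S` be a collection of objects of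
`𝔍(X,E)`. For each `s ∈ S`, let `Ψ^i_s ⊂ H^i(G_{E,s}, Ẑ(1)_s)` … be a collection of Galois cohomology classes provided by each object `s ∈
S`. Then these classes may be assembled into a subset `Ψ ⊂ H^i(G_E, Ẑ(1))` … of the relevant standard Galois cohomology. Proof. Let `Ψ`
… be the union of the images of each element of `Ψ_s` (for each `s ∈ S`) under all the isomorphisms provided by Theorem 8.4.1»):
the union over `s ∈ S` and over ALL anabelomorphisms `φ` of the images. DICTIONARY pointer (not bound): union over all `φ` ↔ the
`⟨(Ind1)∪(Ind2)⟩`-orbit of Kummer classes in OUR `Thm311.LogShells`; Rmk. 8.5.2 (p. 46 l. 27–31): «The adelic version of this corollary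
([Joshi, 2023a], [Joshi, 2024c]) is the key principle which underlies Mochizuki's construction of his Θ-values set in [Mochizuki,
2021c]. For [Mochizuki, 2021c, Corollary 3.12], one uses a specific choice of `S` (for each prime of a fixed number field) whose
construction requires the notions of Θ_gau-links and log-links». [claim: Joshi2021ATS1, status: disputed] -/
def collate (i : ℕ) (S : Set (ATSObj X)) (Ψ : ∀ A : ATSObj X, Set (HG i A)) : Set (HG i (ATSObj.standard X)) :=
  ⋃ A ∈ S, ⋃ φ : A.Y.PiTemp ≃ₜ* X.PiTemp, T.trG A φ i '' Ψ A

/-- Cor. 8.5.1, `ℚ_p`-coefficients / `H^1_f`-version («(`Ψ^i_f ⊂ H^i_f(G_E, Ẑ(1))` resp.)»): collation inside `H^i(G_E, ℚ_p(1))`.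
[claim: Joshi2021ATS1, status: disputed] -/
def collateQ (i : ℕ) (S : Set (ATSObj X)) (Ψ : ∀ A : ATSObj X, Set (HGQ i A)) : Set (HGQ i (ATSObj.standard X)) :=
  ⋃ A ∈ S, ⋃ φ : A.Y.PiTemp ≃ₜ* X.PiTemp, T.trGQ A φ i '' Ψ A

/-- Membership in the collation: a class of some `s ∈ S` transported along some anabelomorphism. [folklore] -/
theorem mem_collate_iff {i : ℕ} {S : Set (ATSObj X)} {Ψ : ∀ A : ATSObj X, Set (HG i A)} {c : HG i (ATSObj.standard X)} :
    c ∈ T.collate i S Ψ ↔ ∃ A ∈ S, ∃ φ : A.Y.PiTemp ≃ₜ* X.PiTemp, ∃ x ∈ Ψ A, T.trG A φ i x = c := by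
  simp only [collate, Set.mem_iUnion, Set.mem_image, exists_prop]

/-- Collation is monotone in the collection `S` and in the classes `Ψ`. [folklore] -/
theorem collate_mono {i : ℕ} {S S' : Set (ATSObj X)} {Ψ Ψ' : ∀ A : ATSObj X, Set (HG i A)} (hS : S ⊆ S')
    (hΨ : ∀ A, Ψ A ⊆ Ψ' A) : T.collate i S Ψ ⊆ T.collate i S' Ψ' := by
  intro c hc
  obtain ⟨A, hA, φ, x, hx, rfl⟩ := T.mem_collate_iff.1 hc
  exact T.mem_collate_iff.2 ⟨A, hS hA, φ, x, hΨ A hx, rfl⟩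

/-- Every class of every member of `S` is collated (through the member's own label `α`). [folklore] -/
theorem image_subset_collate {i : ℕ} {S : Set (ATSObj X)} (Ψ : ∀ A : ATSObj X, Set (HG i A)) {A : ATSObj X} (hA : A ∈ S) :
    T.trG A A.α i '' Ψ A ⊆ T.collate i S Ψ := by
  rintro c ⟨x, hx, rfl⟩
  exact T.mem_collate_iff.2 ⟨A, hA, A.α, x, hx, rfl⟩

/-- **Cor. 8.5.1 (`H^1_f` clause) DERIVED from Thm. 8.4.1 (2)**: `f`-classes collate INTO `H^1_f` of the standard cohomology — if
every `Ψ_s ⊆ H^1_f(G_{E,s}, ℚ_p(1)_s)` then `Ψ ⊆ H^1_f(G_E, ℚ_p(1))`. [folklore] -/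
theorem collateQ_subset_H1f {S : Set (ATSObj X)} {Ψ : ∀ A : ATSObj X, Set (HGQ 1 A)} (hΨ : ∀ A, Ψ A ⊆ C.H1f A) :
    T.collateQ 1 S Ψ ⊆ C.H1f (ATSObj.standard X) := by
  intro c hc
  simp only [collateQ, Set.mem_iUnion, Set.mem_image, exists_prop] at hc
  obtain ⟨A, -, φ, x, hx, rfl⟩ := hc
  rw [← T.map_H1f A φ]
  exact Submodule.mem_map_of_mem (hΨ A hx)

end CohTransport

end KummerGaloisCohomology

end Summit.ABC.IUTFork.Joshi

end
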